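import Literature.AlgebraicGeometry.Deformation.TangentSpaceVectorSpace
import Literature.AlgebraicGeometry.Deformation.EssentialMorphisms
import HarnessLib

/-!
# [Schlessinger1968, (2.17)]: free action of `t_F ⊗ I` on the fibres ⇒ (H₄) — the converse half of «(H₄) is precisely
the condition that this action makes `F(p)⁻¹(η)` a (formally) principal homogeneous space under `t_F ⊗ I`»

Family `hodge` (computation cell `pub-hsemireg`, LIT-W seat «Pridham / derived deformation theory as printed»), layer
`Literature/AlgebraicGeometry/Deformation`; companion of `TangentSpaceVectorSpace.lean` (TSVS), whose §13–§15 type the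
action (2.17) of `F(k[I])` (`≅ t_F ⊗ I`, §19) on the fibres of `F(p)` for a surjection `p : A′ → A` with `𝔪 · ker p = 0`,
its transitivity under (H₁) (`kerAct_transitive`) and its freeness under (H₄) (`kerAct_free`).

[Schlessinger1968, (2.17), p. 213]: «… a group action of `t_F ⊗ I` on the subset `F(p)⁻¹(η)` of `F(A′)`, provided
that subset is not empty. […] (H₁) implies that this action is "transitive," while (H₄) is precisely the condition that
this action makes `F(p)⁻¹(η)` a (formally) principal homogeneous space under `t_F ⊗ I`.» THIS FILE proves the converse
direction of «precisely»: **`ArtinFunctor.H4_of_kerAct_free`** — if `F(k) = {pt}`, `F` satisfies (H₁) and (H₂) (on the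
model `k[ε] → k`), and for EVERY small extension `p` ([Schlessinger1968, Def. 1.2], `IsSmallExtension`) the action on the
fibres of `F(p)` is free, then `F` satisfies (H₄) in the tree's square form (`T1Lifting.lean`'s `ArtinFunctor.H4` =
[FantechiManetti1998ObstructionCalculus, Def. 2.7]: for every cartesian square over a small `p`, against ANY
`q : A″ → A` and ANY model of the fibre product, compatible pairs lift AND lifts are unique). The printed (H₄) is the
case `q = p`; the passage to arbitrary `q` is the content of the proof: two lifts `w, w′ ∈ F(A′ ×_A A″)` with the same
two images differ by some `v ∈ F(k[I′])` along the parallel small side `p′ : A′ ×_A A″ → A″` (transitivity, (H₁));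
applying `F(q′)` and the NATURALITY OF (2.17) IN THE EXTENSION (§1, `ArtinFunctor.map_kerAct_square`:
`F(q′)(v · w) = (F(k[I′] → k[I]) v) · F(q′) w` for any commutative square `p ∘ q′ = q ∘ p′` of surjection data),
`F(k[I′] → k[I]) v` fixes `F(q′) w`, hence is `0` by freeness along `p`; since `k[I′] → k[I]` is an isomorphism for a
cartesian square (`ArtAlg.sqZeroKerMap_bijective`: the kernels correspond), `v = 0` and `w′ = 0 · w = w`.

§1 (pure algebra + functoriality): `ArtAlg.sqZeroKerMap` (`k[I′] → k[I]` induced by the square; values = `q′`),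
`sqZeroKerAug_comp_sqZeroKerMap`, `fiberProdSquareMap` (`q′ × q′`), `fiberProdKerSquareMap` (`q′ × (k[I′] → k[I])`),
**`fiberProdKerMap_natural`** ((2.16) commutes with these: both composites send `(x, y)` to
`(q′x, (q′x)₀ · 1 + q′y − q′x)` because `(q′x)₀ = x₀` — augmentations are unique, TSVS `ArtAlg.augmentation_eq`),
`fiberProdKerInv_natural`, `ArtinFunctor.map_kerAct_square`; for cartesian squares (whose side lemmas
`IsCartesian.surjective_side` / `ker_mul_maximalIdeal_side` live in `EssentialMorphisms.lean`)
`ArtAlg.sqZeroKerMap_bijective`, `sqZeroKerMap_comp_inl`. §2: the theorem, and its form with the printed group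
`t_F ⊗ I` acting (`ArtinFunctor.H4_of_tensorAct_free`, through TSVS §19 `kerTensorEquiv`), and «precisely» as an
`iff` under (H₁), (H₂): `ArtinFunctor.H4_iff_tensorAct_free`. THEOREMS and definitions with body only; no named fact;
no claim about any functor of the cell.

## References

* [Schlessinger1968] M. Schlessinger, Functors of Artin rings, Trans. AMS 130 (1968) 208–222: Def. 1.2 (p. 209),
  (2.16)–(2.17) (p. 213), Thm. 2.11 (H₁)–(H₄) (pp. 212–213).
* [FantechiManetti1998ObstructionCalculus] B. Fantechi, M. Manetti, Obstruction calculus for functors of Artin rings, I,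
  J. Algebra 202 (1998) 541–576: Def. 2.7 (the square form of (H₄)).
* [StacksProject] The Stacks Project, Tag 06GH (fibre products in `𝒞_Λ`, (2): base change of a surjection), Tag 06JI.
-/

namespace Literature.AlgebraicGeometry.Deformation

universe u

/-! ## §1 Naturality of Schlessinger's (2.16) and of the action (2.17) along a commutative square; §2 the converse
half of «(H₄) is precisely the condition …» -/

section SquareNaturality

open IsLocalRing

variable {k : Type u} [Field k] {R₀ R₁ R₂ R₃ : ArtAlg.{u} k}

/-- **`k[I′] → k[I]` induced by a commutative square** (`q′ : R₃ → R₁` over `q : R₂ → R₀`, `p ∘ q′ = q ∘ p′`): the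
restriction of `q′` to the internal `k[I′] ⊆ R₃`, landing in `k[I] ⊆ R₁`. Definition with body.
[cite: Schlessinger1968, (2.16)–(2.17), p. 213] -/
noncomputable def ArtAlg.sqZeroKerMap (p : R₁ →ₐ[k] R₀) (hI : RingHom.ker p * maximalIdeal R₁ = ⊥)
    (p' : R₃ →ₐ[k] R₂) (hI' : RingHom.ker p' * maximalIdeal R₃ = ⊥) (q' : R₃ →ₐ[k] R₁) (q : R₂ →ₐ[k] R₀)
    (hsq : p.comp q' = q.comp p') : (ArtAlg.sqZeroKer p' hI' : Type u) →ₐ[k] (ArtAlg.sqZeroKer p hI : Type u) :=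
  AlgHom.codRestrict (q'.comp (ArtAlg.sqZeroKerVal p' hI')) (ArtAlg.sqZeroKerSubalgebra p) fun x => by
    obtain ⟨c, i, hi, hx⟩ :=
      (ArtAlg.mem_sqZeroKer_iff p' (ArtAlg.sqZeroKerVal p' hI' x)).1 (show ↥(ArtAlg.sqZeroKerSubalgebra p') from x).2
    refine (ArtAlg.mem_sqZeroKer_iff p _).2 ⟨c, q' i, ArtAlg.map_mem_ker_of_square p p' q' q hsq hi, ?_⟩
    change q' (ArtAlg.sqZeroKerVal p' hI' x) = _
    rw [hx, map_add, AlgHom.commutes]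

/-- On values: `k[I′] → k[I]` is `q′`. [cite: Schlessinger1968, (2.16), p. 213] -/
theorem ArtAlg.sqZeroKerVal_sqZeroKerMap (p : R₁ →ₐ[k] R₀) (hI : RingHom.ker p * maximalIdeal R₁ = ⊥)
    (p' : R₃ →ₐ[k] R₂) (hI' : RingHom.ker p' * maximalIdeal R₃ = ⊥) (q' : R₃ →ₐ[k] R₁) (q : R₂ →ₐ[k] R₀)
    (hsq : p.comp q' = q.comp p') (x : (ArtAlg.sqZeroKer p' hI' : Type u)) :
    ArtAlg.sqZeroKerVal p hI (ArtAlg.sqZeroKerMap p hI p' hI' q' q hsq x) = q' (ArtAlg.sqZeroKerVal p' hI' x) :=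
  rfl

/-- Augmentations are compatible with any morphism of `Art_k` (uniqueness of the augmentation).
[cite: Schlessinger1968, §1 p. 208] -/
theorem ArtAlg.aug_comp_eq (q' : R₃ →ₐ[k] R₁) (aug₁ : ↥R₁ →ₐ[k] k) (aug₃ : ↥R₃ →ₐ[k] k) : aug₁.comp q' = aug₃ :=
  ArtAlg.augmentation_eq R₃ _ _

/-- The structure maps to `k` commute with `k[I′] → k[I]`. [cite: Schlessinger1968, (2.16), p. 213] -/
theorem ArtAlg.sqZeroKerAug_comp_sqZeroKerMap (p : R₁ →ₐ[k] R₀) (hI : RingHom.ker p * maximalIdeal R₁ = ⊥)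
    (p' : R₃ →ₐ[k] R₂) (hI' : RingHom.ker p' * maximalIdeal R₃ = ⊥) (q' : R₃ →ₐ[k] R₁) (q : R₂ →ₐ[k] R₀)
    (hsq : p.comp q' = q.comp p') (aug₁ : ↥R₁ →ₐ[k] k) (aug₃ : ↥R₃ →ₐ[k] k) :
    (ArtAlg.sqZeroKerAug p hI aug₁).comp (ArtAlg.sqZeroKerMap p hI p' hI' q' q hsq) = ArtAlg.sqZeroKerAug p' hI' aug₃ := by
  refine AlgHom.ext fun x => ?_
  change aug₁ (q' (ArtAlg.sqZeroKerVal p' hI' x)) = aug₃ (ArtAlg.sqZeroKerVal p' hI' x)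
  exact AlgHom.congr_fun (ArtAlg.aug_comp_eq q' aug₁ aug₃) _

/-- `q′ × q′ : R₃ ×_{R₂} R₃ → R₁ ×_{R₀} R₁`. Definition with body. [cite: Schlessinger1968, (2.16), p. 213] -/
noncomputable def ArtAlg.fiberProdSquareMap (p : R₁ →ₐ[k] R₀) (p' : R₃ →ₐ[k] R₂) (q' : R₃ →ₐ[k] R₁)
    (q : R₂ →ₐ[k] R₀) (hsq : p.comp q' = q.comp p') :
    (ArtAlg.fiberProd p' p' : Type u) →ₐ[k] (ArtAlg.fiberProd p p : Type u) :=
  ArtAlg.fiberProdLift p p (q'.comp (ArtAlg.fiberProdFst p' p')) (q'.comp (ArtAlg.fiberProdSnd p' p')) (by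
    rw [← AlgHom.comp_assoc, ← AlgHom.comp_assoc, hsq, AlgHom.comp_assoc, AlgHom.comp_assoc,
      ArtAlg.comp_fiberProdFst_eq])

/-- `q′ × (k[I′] → k[I]) : R₃ ×_k k[I′] → R₁ ×_k k[I]`. Definition with body. [cite: Schlessinger1968, (2.16), p. 213] -/
noncomputable def ArtAlg.fiberProdKerSquareMap (p : R₁ →ₐ[k] R₀) (hI : RingHom.ker p * maximalIdeal R₁ = ⊥)
    (p' : R₃ →ₐ[k] R₂) (hI' : RingHom.ker p' * maximalIdeal R₃ = ⊥) (q' : R₃ →ₐ[k] R₁) (q : R₂ →ₐ[k] R₀)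
    (hsq : p.comp q' = q.comp p') (aug₁ : ↥R₁ →ₐ[k] k) (aug₃ : ↥R₃ →ₐ[k] k) :
    (ArtAlg.fiberProd (ArtAlg.toBase aug₃) (ArtAlg.sqZeroKerAug p' hI' aug₃) : Type u) →ₐ[k]
      (ArtAlg.fiberProd (ArtAlg.toBase aug₁) (ArtAlg.sqZeroKerAug p hI aug₁) : Type u) :=
  ArtAlg.fiberProdLift _ _ (q'.comp (ArtAlg.fiberProdFst _ _))
    ((ArtAlg.sqZeroKerMap p hI p' hI' q' q hsq).comp (ArtAlg.fiberProdSnd _ _)) (by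
      rw [← AlgHom.comp_assoc, ← AlgHom.comp_assoc, ArtAlg.sqZeroKerAug_comp_sqZeroKerMap p hI p' hI' q' q hsq aug₁ aug₃,
        show (ArtAlg.toBase aug₁).comp q' = ArtAlg.toBase aug₃ from ArtAlg.aug_comp_eq q' aug₁ aug₃,
        ArtAlg.comp_fiberProdFst_eq])

/-- **Schlessinger's (2.16) is natural along the square:** `(2.16)_p ∘ (q′ × q′) = (q′ × (k[I′] → k[I])) ∘ (2.16)_{p′}`
— both send `(x, y)` to `(q′x, (q′x)₀ · 1 + q′y − q′x)`, since `(q′x)₀ = x₀`. [cite: Schlessinger1968, (2.16), p. 213] -/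
theorem ArtAlg.fiberProdKerMap_natural (p : R₁ →ₐ[k] R₀) (hI : RingHom.ker p * maximalIdeal R₁ = ⊥)
    (p' : R₃ →ₐ[k] R₂) (hI' : RingHom.ker p' * maximalIdeal R₃ = ⊥) (q' : R₃ →ₐ[k] R₁) (q : R₂ →ₐ[k] R₀)
    (hsq : p.comp q' = q.comp p') (aug₁ : ↥R₁ →ₐ[k] k) (aug₃ : ↥R₃ →ₐ[k] k) :
    (ArtAlg.fiberProdKerMap p hI aug₁).comp (ArtAlg.fiberProdSquareMap p p' q' q hsq) =
      (ArtAlg.fiberProdKerSquareMap p hI p' hI' q' q hsq aug₁ aug₃).comp (ArtAlg.fiberProdKerMap p' hI' aug₃) := by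
  refine AlgHom.ext fun z => ArtAlg.fiberProd_ext _ _ ?_ ?_
  · rfl
  · have hinj : Function.Injective (ArtAlg.sqZeroKerVal p hI) := Subtype.val_injective
    apply hinj
    change ArtAlg.sqZeroKerVal p hI (ArtAlg.fiberProdSnd _ _ (ArtAlg.fiberProdKerMap p hI aug₁
        (ArtAlg.fiberProdSquareMap p p' q' q hsq z))) =
      q' (ArtAlg.sqZeroKerVal p' hI' (ArtAlg.fiberProdSnd _ _ (ArtAlg.fiberProdKerMap p' hI' aug₃ z)))
    rw [ArtAlg.sqZeroKerVal_fiberProdSnd_fiberProdKerMap, ArtAlg.sqZeroKerVal_fiberProdSnd_fiberProdKerMap,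
      ArtAlg.schlessingerMap_apply, ArtAlg.schlessingerMap_apply]
    change algebraMap k R₁ (aug₁ (q' (ArtAlg.fiberProdFst p' p' z))) +
        (q' (ArtAlg.fiberProdSnd p' p' z) - q' (ArtAlg.fiberProdFst p' p' z)) = _
    rw [map_add, map_sub, AlgHom.commutes,
      show aug₁ (q' (ArtAlg.fiberProdFst p' p' z)) = aug₃ (ArtAlg.fiberProdFst p' p' z) from
        AlgHom.congr_fun (ArtAlg.aug_comp_eq q' aug₁ aug₃) _]

/-- `(2.16)⁻¹` is natural along the square too: `(2.16)⁻¹_p ∘ (q′ × (k[I′] → k[I])) = (q′ × q′) ∘ (2.16)⁻¹_{p′}`.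
[cite: Schlessinger1968, (2.16), p. 213] -/
theorem ArtAlg.fiberProdKerInv_natural (p : R₁ →ₐ[k] R₀) (hI : RingHom.ker p * maximalIdeal R₁ = ⊥)
    (p' : R₃ →ₐ[k] R₂) (hI' : RingHom.ker p' * maximalIdeal R₃ = ⊥) (q' : R₃ →ₐ[k] R₁) (q : R₂ →ₐ[k] R₀)
    (hsq : p.comp q' = q.comp p') (aug₁ : ↥R₁ →ₐ[k] k) (aug₃ : ↥R₃ →ₐ[k] k) :
    (ArtAlg.fiberProdKerInv p hI aug₁).comp (ArtAlg.fiberProdKerSquareMap p hI p' hI' q' q hsq aug₁ aug₃) =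
      (ArtAlg.fiberProdSquareMap p p' q' q hsq).comp (ArtAlg.fiberProdKerInv p' hI' aug₃) := by
  calc (ArtAlg.fiberProdKerInv p hI aug₁).comp (ArtAlg.fiberProdKerSquareMap p hI p' hI' q' q hsq aug₁ aug₃)
      = ((ArtAlg.fiberProdKerInv p hI aug₁).comp (ArtAlg.fiberProdKerSquareMap p hI p' hI' q' q hsq aug₁ aug₃)).comp
          ((ArtAlg.fiberProdKerMap p' hI' aug₃).comp (ArtAlg.fiberProdKerInv p' hI' aug₃)) := by
        rw [ArtAlg.fiberProdKerMap_comp_fiberProdKerInv, AlgHom.comp_id]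
    _ = (ArtAlg.fiberProdKerInv p hI aug₁).comp (((ArtAlg.fiberProdKerMap p hI aug₁).comp
          (ArtAlg.fiberProdSquareMap p p' q' q hsq)).comp (ArtAlg.fiberProdKerInv p' hI' aug₃)) := by
        rw [ArtAlg.fiberProdKerMap_natural p hI p' hI' q' q hsq aug₁ aug₃]
        simp only [AlgHom.comp_assoc]
    _ = (ArtAlg.fiberProdSquareMap p p' q' q hsq).comp (ArtAlg.fiberProdKerInv p' hI' aug₃) := by
        rw [← AlgHom.comp_assoc, ← AlgHom.comp_assoc, ArtAlg.fiberProdKerInv_comp_fiberProdKerMap, AlgHom.id_comp]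

variable (F : ArtinFunctor.{u} k)

/-- **The action (2.17) is natural in the extension:** for a commutative square `p ∘ q′ = q ∘ p′` of surjection data
(`𝔪 · ker = 0` on both), `F(q′)(v · w) = (F(k[I′] → k[I]) v) · F(q′) w` — the brick needed for the converse half of
«(H₄) is precisely the condition that this action makes `F(p)⁻¹(η)` a principal homogeneous space».
[cite: Schlessinger1968, (2.17), p. 213] -/
theorem ArtinFunctor.map_kerAct_square (pt : F.obj (ArtAlg.base k)) (hpt : ∀ a, a = pt)
    (p : R₁ →ₐ[k] R₀) (hI : RingHom.ker p * maximalIdeal R₁ = ⊥) (p' : R₃ →ₐ[k] R₂)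
    (hI' : RingHom.ker p' * maximalIdeal R₃ = ⊥) (q' : R₃ →ₐ[k] R₁) (q : R₂ →ₐ[k] R₀) (hsq : p.comp q' = q.comp p')
    (aug₁ : ↥R₁ →ₐ[k] k) (aug₃ : ↥R₃ →ₐ[k] k) (hKI : F.IsBijectiveAlong (ArtAlg.sqZeroKerAug p hI aug₁))
    (hKI' : F.IsBijectiveAlong (ArtAlg.sqZeroKerAug p' hI' aug₃)) (v : F.obj (ArtAlg.sqZeroKer p' hI'))
    (w : F.obj R₃) :
    F.map q' (F.kerAct pt hpt p' hI' aug₃ hKI' v w) =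
      F.kerAct pt hpt p hI aug₁ hKI (F.map (R := ArtAlg.sqZeroKer p' hI') (S := ArtAlg.sqZeroKer p hI)
        (ArtAlg.sqZeroKerMap p hI p' hI' q' q hsq) v) (F.map q' w) := by
  let e := F.fiberProdKerPairEquiv pt hpt p hI aug₁ hKI
  let e' := F.fiberProdKerPairEquiv pt hpt p' hI' aug₃ hKI'
  -- (C) the pair equivalences intertwine `q′ × (k[I′] → k[I])`
  have hC : F.map (ArtAlg.fiberProdKerSquareMap p hI p' hI' q' q hsq aug₁ aug₃) (e'.symm (v, w)) =
      e.symm (F.map (R := ArtAlg.sqZeroKer p' hI') (S := ArtAlg.sqZeroKer p hI)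
        (ArtAlg.sqZeroKerMap p hI p' hI' q' q hsq) v, F.map q' w) := by
    apply e.injective
    rw [Equiv.apply_symm_apply]
    have h1 := congrArg Prod.fst (e'.apply_symm_apply (v, w))
    have h2 := congrArg Prod.snd (e'.apply_symm_apply (v, w))
    change F.map (ArtAlg.fiberProdSnd _ _) (e'.symm (v, w)) = v at h1
    change F.map (ArtAlg.fiberProdFst _ _) (e'.symm (v, w)) = w at h2
    change (F.map (ArtAlg.fiberProdSnd _ _) (F.map (ArtAlg.fiberProdKerSquareMap p hI p' hI' q' q hsq aug₁ aug₃) _),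
        F.map (ArtAlg.fiberProdFst _ _) (F.map (ArtAlg.fiberProdKerSquareMap p hI p' hI' q' q hsq aug₁ aug₃) _)) = _
    rw [← F.map_comp, ← F.map_comp, ArtAlg.fiberProdKerSquareMap, ArtAlg.fiberProdSnd_comp_lift,
      ArtAlg.fiberProdFst_comp_lift, F.map_comp, F.map_comp, h1, h2]
  change F.map q' (F.map (ArtAlg.fiberProdSnd p' p') (F.map (ArtAlg.fiberProdKerInv p' hI' aug₃) (e'.symm (v, w)))) =
    F.map (ArtAlg.fiberProdSnd p p) (F.map (ArtAlg.fiberProdKerInv p hI aug₁) (e.symm (_, F.map q' w)))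
  rw [← hC, ← F.map_comp, ← F.map_comp, ← F.map_comp, ← F.map_comp]
  conv_rhs => rw [AlgHom.comp_assoc, ArtAlg.fiberProdKerInv_natural, ← AlgHom.comp_assoc, ArtAlg.fiberProdSquareMap,
    ArtAlg.fiberProdSnd_comp_lift]

/-! ### Cartesian squares over a surjection with `𝔪 · ker = 0`: the parallel side inherits both properties, and
`k[I′] → k[I]` is an isomorphism -/

omit F in
/-- In a cartesian square over a surjection `p` (with `𝔪 · ker = 0` on both sides), `k[I′] → k[I]` is BIJECTIVE (the
kernels correspond: `q′ : ker p′ ≅ ker p`). [cite: StacksProject, Tag 06GH (2)] [cite: Schlessinger1968, (2.16), p. 213] -/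
theorem ArtAlg.sqZeroKerMap_bijective (p : R₁ →ₐ[k] R₀) (hI : RingHom.ker p * maximalIdeal R₁ = ⊥)
    (p' : R₃ →ₐ[k] R₂) (hI' : RingHom.ker p' * maximalIdeal R₃ = ⊥) (q' : R₃ →ₐ[k] R₁) (q : R₂ →ₐ[k] R₀)
    (hc : IsCartesian k p q q' p') (aug₁ : ↥R₁ →ₐ[k] k) (aug₃ : ↥R₃ →ₐ[k] k) :
    Function.Bijective (ArtAlg.sqZeroKerMap p hI p' hI' q' q hc.comm) := by
  have hval : Function.Injective (ArtAlg.sqZeroKerVal p hI) := Subtype.val_injective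
  have hval' : Function.Injective (ArtAlg.sqZeroKerVal p' hI') := Subtype.val_injective
  refine ⟨fun x y hxy => ?_, fun y => ?_⟩
  · -- scalar parts agree (apply `aug₁`, compatible with `aug₃`), then the `I′`-parts by `lift_unique`
    have hq : q' (ArtAlg.sqZeroKerVal p' hI' x) = q' (ArtAlg.sqZeroKerVal p' hI' y) := by
      rw [← ArtAlg.sqZeroKerVal_sqZeroKerMap p hI p' hI' q' q hc.comm, ← ArtAlg.sqZeroKerVal_sqZeroKerMap p hI p' hI' q' q hc.comm,
        hxy]
    have hx := ArtAlg.sub_algebraMap_aug_mem p' aug₃ (show ↥(ArtAlg.sqZeroKerSubalgebra p') from x).2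
    have hy := ArtAlg.sub_algebraMap_aug_mem p' aug₃ (show ↥(ArtAlg.sqZeroKerSubalgebra p') from y).2
    have haug : aug₃ (ArtAlg.sqZeroKerVal p' hI' x) = aug₃ (ArtAlg.sqZeroKerVal p' hI' y) := by
      have h3 := AlgHom.congr_fun (ArtAlg.aug_comp_eq q' aug₁ aug₃)
      rw [← h3, ← h3, AlgHom.comp_apply, AlgHom.comp_apply, hq]
    apply hval'
    have hx' : p' (ArtAlg.sqZeroKerVal p' hI' x - algebraMap k R₃ (aug₃ (ArtAlg.sqZeroKerVal p' hI' x))) = 0 :=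
      RingHom.mem_ker.1 hx
    have hy' : p' (ArtAlg.sqZeroKerVal p' hI' y - algebraMap k R₃ (aug₃ (ArtAlg.sqZeroKerVal p' hI' y))) = 0 :=
      RingHom.mem_ker.1 hy
    have key : ArtAlg.sqZeroKerVal p' hI' x - algebraMap k R₃ (aug₃ (ArtAlg.sqZeroKerVal p' hI' x)) =
        ArtAlg.sqZeroKerVal p' hI' y - algebraMap k R₃ (aug₃ (ArtAlg.sqZeroKerVal p' hI' y)) := by
      refine hc.lift_unique _ _ ?_ ?_
      · rw [map_sub, map_sub, AlgHom.commutes, AlgHom.commutes, hq, haug]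
      · rw [hx', hy']
    have := congrArg (fun t => t + algebraMap k R₃ (aug₃ (ArtAlg.sqZeroKerVal p' hI' x))) key
    simp only [sub_add_cancel] at this
    rw [this, haug, sub_add_cancel]
  · -- lift `(i, 0)` for the `I`-part `i` of `y`
    obtain ⟨c, i, hi, hyci⟩ := (ArtAlg.mem_sqZeroKer_iff p (ArtAlg.sqZeroKerVal p hI y)).1
      (show ↥(ArtAlg.sqZeroKerSubalgebra p) from y).2
    obtain ⟨d, hd₁, hd₂⟩ := hc.exists_lift i 0 (by rw [map_zero]; exact RingHom.mem_ker.1 hi)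
    have hd : d ∈ RingHom.ker p' := RingHom.mem_ker.2 hd₂
    refine ⟨⟨algebraMap k R₃ c + d, (ArtAlg.mem_sqZeroKer_iff p' _).2 ⟨c, d, hd, rfl⟩⟩, ?_⟩
    apply hval
    rw [ArtAlg.sqZeroKerVal_sqZeroKerMap, hyci]
    change q' (algebraMap k R₃ c + d) = _
    rw [map_add, AlgHom.commutes, hd₁]

omit F in
/-- `(k[I′] → k[I]) ∘ (k → k[I′]) = (k → k[I])`. [cite: Schlessinger1968, (2.16), p. 213] -/
theorem ArtAlg.sqZeroKerMap_comp_inl (p : R₁ →ₐ[k] R₀) (hI : RingHom.ker p * maximalIdeal R₁ = ⊥)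
    (p' : R₃ →ₐ[k] R₂) (hI' : RingHom.ker p' * maximalIdeal R₃ = ⊥) (q' : R₃ →ₐ[k] R₁) (q : R₂ →ₐ[k] R₀)
    (hsq : p.comp q' = q.comp p') :
    (ArtAlg.sqZeroKerMap p hI p' hI' q' q hsq).comp (ArtAlg.sqZeroKerInl p' hI') = ArtAlg.sqZeroKerInl p hI :=
  AlgHom.ext fun c => (ArtAlg.sqZeroKerMap p hI p' hI' q' q hsq).commutes c

/-- **[Schlessinger1968, (2.17)], the converse half of «(H₄) is precisely the condition that this action makes
`F(p)⁻¹(η)` a (formally) principal homogeneous space under `t_F ⊗ I`»:** if `F(k) = {pt}`, `F` satisfies (H₁) and (H₂)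
(on the model `k[ε] → k`), and for EVERY small extension `p : A′ → A` the action of `F(k[I])` on the fibres of `F(p)`
is FREE, then `F` satisfies (H₄) — in the tree's square form ([FantechiManetti1998ObstructionCalculus, Def. 2.7]:
existence AND uniqueness of lifts for every cartesian square over a small `p`, against any `q`). Proof: existence is
(H₁); for uniqueness, two lifts `w, w′ ∈ F(A′ ×_A A″)` with the same images differ by some `v ∈ F(k[I′])` along the
small side `p′` ((H₁), transitivity); applying `F(q′)` and the naturality of (2.17) in the extension
(`map_kerAct_square`), `F(k[I′] → k[I]) v` fixes `F(q′) w`, so it is `0` by freeness along `p`; as `k[I′] ≅ k[I]`,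
`v = 0` and `w′ = 0 · w = w`. [cite: Schlessinger1968, (2.17), p. 213]
[cite: FantechiManetti1998ObstructionCalculus, Def. 2.7] -/
theorem ArtinFunctor.H4_of_kerAct_free (h1 : F.H1) (pt : F.obj (ArtAlg.base k)) (hpt : ∀ a, a = pt)
    (h2 : F.IsBijectiveAlong (ArtAlg.sqZeroExtAug (k := k) k))
    (hfree : ∀ ⦃R₀ R₁ : ArtAlg.{u} k⦄ (p : R₁ →ₐ[k] R₀) (hp : IsSmallExtension k p) (aug : ↥R₁ →ₐ[k] k)
      (η' : F.obj R₁) (v v' : F.obj (ArtAlg.sqZeroKer p hp.ker_mul_maximalIdeal)),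
      F.kerAct pt hpt p hp.ker_mul_maximalIdeal aug (F.isBijectiveAlong_sqZeroKerAug h2 p hp.ker_mul_maximalIdeal aug) v η' =
        F.kerAct pt hpt p hp.ker_mul_maximalIdeal aug (F.isBijectiveAlong_sqZeroKerAug h2 p hp.ker_mul_maximalIdeal aug) v' η'
        → v = v') :
    F.H4 := by
  intro R₀ R₁ R₂ R₃ p q q' p' hc hp
  refine ⟨h1 p q q' p' hc hp, fun w w' hq' hp' => ?_⟩
  obtain ⟨aug₁⟩ := R₁.exists_augmentation
  obtain ⟨aug₃⟩ := R₃.exists_augmentation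
  have hI := hp.ker_mul_maximalIdeal
  have hI' : RingHom.ker p' * maximalIdeal R₃ = ⊥ := hc.ker_mul_maximalIdeal_side hI
  have hKI := F.isBijectiveAlong_sqZeroKerAug h2 p hI aug₁
  have hKI' := F.isBijectiveAlong_sqZeroKerAug h2 p' hI' aug₃
  -- `w′ = v · w` along the small side `p′`
  obtain ⟨v, hv⟩ := F.kerAct_transitive h1 pt hpt p' (hc.surjective_side hp.surjective) hI' aug₃ hKI' w w' hp'
  -- apply `F(q′)`: `(F(k[I′] → k[I]) v) · F(q′) w = F(q′) w`
  have key := F.map_kerAct_square pt hpt p hI p' hI' q' q hc.comm aug₁ aug₃ hKI hKI' v w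
  rw [hv, ← hq'] at key
  -- freeness along `p`: `F(k[I′] → k[I]) v = 0`
  have h0 := hfree p hp aug₁ (F.map q' w) _ (F.map (ArtAlg.sqZeroKerInl p hI) pt)
    (key.symm.trans (F.kerAct_zero pt hpt p hI aug₁ hKI (F.map q' w)).symm)
  -- `k[I′] ≅ k[I]`, so `v = 0`
  let e := AlgEquiv.ofBijective _ (ArtAlg.sqZeroKerMap_bijective p hI p' hI' q' q hc aug₁ aug₃)
  have hinj : Function.Injective (F.map (R := ArtAlg.sqZeroKer p' hI') (S := ArtAlg.sqZeroKer p hI)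
      (ArtAlg.sqZeroKerMap p hI p' hI' q' q hc.comm)) := fun a b hab => by
    have h' := congrArg (F.map (R := ArtAlg.sqZeroKer p hI) (S := ArtAlg.sqZeroKer p' hI') e.symm.toAlgHom) hab
    have hcomp : e.symm.toAlgHom.comp (ArtAlg.sqZeroKerMap p hI p' hI' q' q hc.comm) = AlgHom.id k _ :=
      AlgHom.ext fun z => e.symm_apply_apply z
    rw [← F.map_comp, ← F.map_comp, hcomp, F.map_id, F.map_id] at h'
    exact h'
  have hv0 : v = F.map (ArtAlg.sqZeroKerInl p' hI') pt := by
    apply hinj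
    rw [h0, ← F.map_comp, ArtAlg.sqZeroKerMap_comp_inl]
  rw [← hv, hv0, F.kerAct_zero]

/-- **The same with the printed group `t_F ⊗ I` acting** (TSVS §19 `tensorAct`; the comparison
`t_F ⊗_k I ≅ F(k[I])` is a bijection, so freeness of one action is freeness of the other): if for every small
extension `p` the action of `t_F ⊗ I` on the fibres of `F(p)` is free, then (H₄).
[cite: Schlessinger1968, (2.17), p. 213] [cite: FantechiManetti1998ObstructionCalculus, Def. 2.7] -/
theorem ArtinFunctor.H4_of_tensorAct_free (h1 : F.H1) (pt : F.obj (ArtAlg.base k)) (hpt : ∀ a, a = pt)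
    (h2 : F.IsBijectiveAlong (ArtAlg.sqZeroExtAug (k := k) k))
    (hfree : ∀ ⦃R₀ R₁ : ArtAlg.{u} k⦄ (p : R₁ →ₐ[k] R₀) (hp : IsSmallExtension k p) (aug : ↥R₁ →ₐ[k] k)
      (η' : F.obj R₁)
      (τ τ' : haveI : Module.Finite k ↥R₁ := R₁.moduleFinite
        letI := F.tangentAddCommGroup pt hpt k h2; letI := F.tangentModule pt hpt k h2
        TensorProduct k (F.obj (ArtAlg.sqZeroExt (k := k) k)) ↥(ArtAlg.kerSubmodule p)),
      F.tensorAct pt hpt h2 p hp.ker_mul_maximalIdeal aug τ η' = F.tensorAct pt hpt h2 p hp.ker_mul_maximalIdeal aug τ' η'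
        → τ = τ') :
    F.H4 := by
  refine F.H4_of_kerAct_free h1 pt hpt h2 fun R₀ R₁ p hp aug η' v v' hvv' => ?_
  haveI : Module.Finite k ↥R₁ := R₁.moduleFinite
  letI := F.tangentAddCommGroup pt hpt k h2; letI := F.tangentModule pt hpt k h2
  letI := F.kerAddCommGroup pt hpt h2 p hp.ker_mul_maximalIdeal aug
  let Ψ := F.kerTensorEquiv pt hpt h2 p hp.ker_mul_maximalIdeal aug
  have h := hfree p hp aug η' (Ψ.symm v) (Ψ.symm v') (by
    change F.kerAct pt hpt p _ aug _ (Ψ (Ψ.symm v)) η' = F.kerAct pt hpt p _ aug _ (Ψ (Ψ.symm v')) η'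
    rw [AddEquiv.apply_symm_apply, AddEquiv.apply_symm_apply]
    exact hvv')
  exact Ψ.symm.injective h

/-- **[Schlessinger1968, (2.17)] «(H₄) is PRECISELY the condition …», both directions:** for `F` with `F(k) = {pt}`,
(H₁) and (H₂) (on the model `k[ε] → k`), `F` satisfies (H₄) (tree square form) if and only if for every small
extension `p : A′ → A` the action of `t_F ⊗ I` on the fibres of `F(p)` is free (transitivity being automatic from
(H₁), TSVS `tensorAct_transitive`). (⇒) is TSVS `tensorAct_free`; (⇐) is `H4_of_tensorAct_free`.
[cite: Schlessinger1968, (2.17), p. 213] [cite: FantechiManetti1998ObstructionCalculus, Def. 2.7] -/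
theorem ArtinFunctor.H4_iff_tensorAct_free (h1 : F.H1) (pt : F.obj (ArtAlg.base k)) (hpt : ∀ a, a = pt)
    (h2 : F.IsBijectiveAlong (ArtAlg.sqZeroExtAug (k := k) k)) :
    F.H4 ↔ ∀ ⦃R₀ R₁ : ArtAlg.{u} k⦄ (p : R₁ →ₐ[k] R₀) (hp : IsSmallExtension k p) (aug : ↥R₁ →ₐ[k] k)
      (η' : F.obj R₁)
      (τ τ' : haveI : Module.Finite k ↥R₁ := R₁.moduleFinite
        letI := F.tangentAddCommGroup pt hpt k h2; letI := F.tangentModule pt hpt k h2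
        TensorProduct k (F.obj (ArtAlg.sqZeroExt (k := k) k)) ↥(ArtAlg.kerSubmodule p)),
      F.tensorAct pt hpt h2 p hp.ker_mul_maximalIdeal aug τ η' = F.tensorAct pt hpt h2 p hp.ker_mul_maximalIdeal aug τ' η'
        → τ = τ' :=
  ⟨fun h4 _ _ p hp aug η' τ τ' h => F.tensorAct_free h4 pt hpt h2 p hp.surjective hp.ker_mul_maximalIdeal aug η' τ τ' h,
    fun hfree => F.H4_of_tensorAct_free h1 pt hpt h2 hfree⟩

end SquareNaturality

end Literature.AlgebraicGeometry.Deformation
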